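import Summits.Ventures.CertifiedArithmetic.Expansions.IncircleStageB
import Summits.Ventures.CertifiedArithmetic.Expansions.EstimateRelativeError
import Mathlib.Tactic.NormNum

/-!
# Stage B of INCIRCLE is sound — the unconditional statements

NEW WORK in the sense of this development (a corollary file; nothing here is a literature fact).
`IncircleStageB.lean` proves the soundness of the stage-B test of `incircleadapt` with
`K = (4 + 56ε)ε` RELATIVE to one explicit hypothesis, the `3ε` relative error bound of `estimate` on
W-expansions of floats.  `EstimateRelativeError.lean` proves exactly that bound
(`abs_estimate_sub_sum_le_of_isWeakExpansion`, every round-to-nearest, `p ≥ 2`).  This file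
discharges the hypothesis: the three theorems below are `incircleStageB_*_of_estimate` with `hest3`
supplied, and say nothing more.

* `incircleStageB_correct` — `p ≥ 6`, `fl` a `RoundoffBelow 2` round-to-nearest into `F(p, emin)`,
  coordinates in `F(p, e₀)` with `emin ≤ e₀`, `emin + 2p ≤ 4e₀`, `tp` error-free on `F(p, e₀)²`,
  `F(p, 2e₀) × F(p, e₀)` and `F(p, 3e₀) × F(p, e₀)`: if stage B (coefficient `iccerrboundB56 p`,
  stage A's permanent) returns `d`, then `d > 0 ↔ (9) > 0` and `d < 0 ↔ (9) < 0` for the exact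
  `incircleDet`.
* `incircleStageB_fma_correct`, `incircleStageB_dekker_correct` — the FMA two-product; Dekker's
  TWO-PRODUCT with `predicates.c`'s splitter (`p ≤ 2s ≤ p + 1`, rounding odd,
  `e₀ ≥ emin + p − 1`, `2e₀ ≥ emin + 2p − 1`, `4e₀ ≥ emin + 2p`).

HONEST CAVEATS, unchanged: exact model over `ℚ`, no overflow; for binary64 the format hypothesis
means coordinates that are multiples of `2^−242`; the certified coefficient is ours, `(4 + 56ε)ε`,
not `predicates.c`'s `(4 + 48ε)ε` (recorded in `IncircleStageBMargins.lean`, not adjudicated);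
stages C–D are not treated here.

References: J. R. Shewchuk, Discrete Comput. Geom. 18 (1997) 305–363, §4.4 and `predicates.c`
[Shewchuk1997].
-/

namespace Summit.Ventures.CertifiedArithmetic.Expansions

open Literature.ComputerArithmetic.JeannerodRump2018
open Literature.ComputerArithmetic.BoldoJeannerodMelquiondMuller2023 hiding twoSum twoSum_fst
  isFloat_twoSum
open Literature.ComputerArithmetic.Shewchuk1997

variable {p : ℕ} {emin : ℤ} {fl : ℚ → ℚ}

/-- **THE STAGE-B TEST OF `incircleadapt` IS SOUND with `K = (4 + 56ε)ε`** (`p ≥ 6`, any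
`RoundoffBelow 2` round-to-nearest, coordinates in `F(p, e₀)` with `emin ≤ e₀`, `emin + 2p ≤ 4e₀`,
two-product error-free on `F(p, e₀)²`, `F(p, 2e₀) × F(p, e₀)`, `F(p, 3e₀) × F(p, e₀)`): if stage B
returns `d`, then `d > 0 ↔ (9) > 0` and `d < 0 ↔ (9) < 0`. -/
theorem incircleStageB_correct (hp : 6 ≤ p) (hfl : IsRoundNearest p emin fl)
    (hfl2 : RoundoffBelow 2 fl) {e₀ : ℤ} (he₀ : emin ≤ e₀) (h4 : emin + 2 * p ≤ e₀ + e₀ + e₀ + e₀)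
    {a₁ a₂ b₁ b₂ c₁ c₂ d₁ d₂ : ℚ}
    (ha₁ : IsFloat p e₀ a₁) (ha₂ : IsFloat p e₀ a₂) (hb₁ : IsFloat p e₀ b₁)
    (hb₂ : IsFloat p e₀ b₂) (hc₁ : IsFloat p e₀ c₁) (hc₂ : IsFloat p e₀ c₂)
    (hd₁ : IsFloat p e₀ d₁) (hd₂ : IsFloat p e₀ d₂)
    {tp : ℚ → ℚ → ℚ × ℚ}
    (htp : ∀ x y, IsFloat p e₀ x → IsFloat p e₀ y → ExactTwoProd p emin fl tp x y)
    (htp' : ∀ x y, IsFloat p (e₀ + e₀) x → IsFloat p e₀ y → ExactTwoProd p emin fl tp x y)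
    (htp'' : ∀ x y, IsFloat p (e₀ + e₀ + e₀) x → IsFloat p e₀ y → ExactTwoProd p emin fl tp x y)
    {d : ℚ}
    (hB : incircleStageB tp fl (iccerrboundB56 p) (incirclePermanent fl a₁ a₂ b₁ b₂ c₁ c₂ d₁ d₂)
      a₁ a₂ b₁ b₂ c₁ c₂ d₁ d₂ = some d) :
    (0 < d ↔ 0 < incircleDet a₁ a₂ b₁ b₂ c₁ c₂ d₁ d₂) ∧
      (d < 0 ↔ incircleDet a₁ a₂ b₁ b₂ c₁ c₂ d₁ d₂ < 0) :=
  incircleStageB_correct_of_estimate hp hfl hfl2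
    (fun _ hF hW =>
      abs_estimate_sub_sum_le_of_isWeakExpansion (le_trans (by norm_num) hp) hfl hF hW)
    he₀ h4 ha₁ ha₂ hb₁ hb₂ hc₁ hc₂ hd₁ hd₂ htp htp' htp'' hB

/-- **Stage B with the FMA two-product** is sound (`p ≥ 6`, any `RoundoffBelow 2`
round-to-nearest, coordinates in `F(p, e₀)` with `emin ≤ e₀`, `emin + 2p ≤ 4e₀`). -/
theorem incircleStageB_fma_correct (hp : 6 ≤ p) (hfl : IsRoundNearest p emin fl)
    (hfl2 : RoundoffBelow 2 fl) {e₀ : ℤ} (he₀ : emin ≤ e₀) (h4 : emin + 2 * p ≤ e₀ + e₀ + e₀ + e₀)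
    {a₁ a₂ b₁ b₂ c₁ c₂ d₁ d₂ : ℚ}
    (ha₁ : IsFloat p e₀ a₁) (ha₂ : IsFloat p e₀ a₂) (hb₁ : IsFloat p e₀ b₁)
    (hb₂ : IsFloat p e₀ b₂) (hc₁ : IsFloat p e₀ c₁) (hc₂ : IsFloat p e₀ c₂)
    (hd₁ : IsFloat p e₀ d₁) (hd₂ : IsFloat p e₀ d₂) {d : ℚ}
    (hB : incircleStageB (twoProdFMA fl) fl (iccerrboundB56 p)
      (incirclePermanent fl a₁ a₂ b₁ b₂ c₁ c₂ d₁ d₂) a₁ a₂ b₁ b₂ c₁ c₂ d₁ d₂ = some d) :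
    (0 < d ↔ 0 < incircleDet a₁ a₂ b₁ b₂ c₁ c₂ d₁ d₂) ∧
      (d < 0 ↔ incircleDet a₁ a₂ b₁ b₂ c₁ c₂ d₁ d₂ < 0) :=
  incircleStageB_fma_correct_of_estimate hp hfl hfl2
    (fun _ hF hW =>
      abs_estimate_sub_sum_le_of_isWeakExpansion (le_trans (by norm_num) hp) hfl hF hW)
    he₀ h4 ha₁ ha₂ hb₁ hb₂ hc₁ hc₂ hd₁ hd₂ hB

/-- **Stage B with Shewchuk's TWO-PRODUCT** (Dekker, split point `s`, `p ≤ 2s ≤ p + 1`, rounding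
odd and `RoundoffBelow 2`) is sound (`p ≥ 6`, coordinates in `F(p, e₀)` with `e₀ ≥ emin + p − 1`,
`2e₀ ≥ emin + 2p − 1`, `4e₀ ≥ emin + 2p`). -/
theorem incircleStageB_dekker_correct (hp : 6 ≤ p) {s : ℕ} (hs2 : p ≤ 2 * s)
    (hs2' : 2 * s ≤ p + 1) (hfl : IsRoundNearest p emin fl) (hodd : ∀ t, fl (-t) = -fl t)
    (hfl2 : RoundoffBelow 2 fl) {e₀ : ℤ} (h1 : emin + p - 1 ≤ e₀)
    (h2 : emin + 2 * p - 1 ≤ e₀ + e₀) (h4 : emin + 2 * p ≤ e₀ + e₀ + e₀ + e₀)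
    {a₁ a₂ b₁ b₂ c₁ c₂ d₁ d₂ : ℚ}
    (ha₁ : IsFloat p e₀ a₁) (ha₂ : IsFloat p e₀ a₂) (hb₁ : IsFloat p e₀ b₁)
    (hb₂ : IsFloat p e₀ b₂) (hc₁ : IsFloat p e₀ c₁) (hc₂ : IsFloat p e₀ c₂)
    (hd₁ : IsFloat p e₀ d₁) (hd₂ : IsFloat p e₀ d₂) {d : ℚ}
    (hB : incircleStageB (twoProduct fl s) fl (iccerrboundB56 p)
      (incirclePermanent fl a₁ a₂ b₁ b₂ c₁ c₂ d₁ d₂) a₁ a₂ b₁ b₂ c₁ c₂ d₁ d₂ = some d) :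
    (0 < d ↔ 0 < incircleDet a₁ a₂ b₁ b₂ c₁ c₂ d₁ d₂) ∧
      (d < 0 ↔ incircleDet a₁ a₂ b₁ b₂ c₁ c₂ d₁ d₂ < 0) :=
  incircleStageB_dekker_correct_of_estimate hp hs2 hs2' hfl hodd hfl2
    (fun _ hF hW =>
      abs_estimate_sub_sum_le_of_isWeakExpansion (le_trans (by norm_num) hp) hfl hF hW)
    h1 h2 h4 ha₁ ha₂ hb₁ hb₂ hc₁ hc₂ hd₁ hd₂ hB

end Summit.Ventures.CertifiedArithmetic.Expansions
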